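import Summits.QuantumAdvantage.QuantumAdvantage.Theorems.MobiusLadderLiouvilleOrthogonalTC0TopDigits
import Summits.QuantumAdvantage.QuantumAdvantage.Theorems.MobiusLadderLiouvilleOrthogonalTC0StubTopDigitsMoebius
import Summits.QuantumAdvantage.QuantumAdvantage.Theorems.MobiusLadderLiouvilleOrthogonalTC0StubScanMoebius
import HarnessLib

/-!
# Crux `MobiusLadder.LiouvilleOrthogonalTC0` (stmt-QuantumAdvantage-1393), line `Sketch`, skeleton v9.1:
# the Möbius twins of the top-digits and finite-state-scan rungs (Kalai's `TC⁰` conjecture on these classes)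

The crux is equivalent to G. Kalai's catalogued `TC⁰` conjecture for `μ`
(`liouvilleOrthogonalTC0_iff_kalai`, `…MoebiusBridge.lean`), but the bridge is not class-by-class, so the
`μ`-forms of the v9 rungs are proved directly (wave 2 of lead c6: `stub_topDigits_moebius` p140051 —
Matomäki–Radziwiłł for `μ`, unconditional; `stub_scan_moebius` p139966 — Müllner's theorem, which is
natively about `μ`). In circuit language:

* `moebius_orthogonal_circuit_topDigits` — UNCONDITIONAL: for every unbounded `ψ` and `ε > 0`,
  eventually every circuit on the `n` digits (any gates, depth, size) whose value ignores the inputs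
  `x_i`, `i < ψ(n)`, has `|Σ_{N<2ⁿ} μ(N) sgn C(bits N)| ≤ ε 2ⁿ` — Kalai's conjecture holds on this class;
* `moebius_orthogonal_circuit_scan_of_mullner`, `moebius_orthogonal_circuit_scanMSB_of_mullner` —
  modulo the printed Müllner 2017 Thm. 1.2 (`mullner_moebius_automatic`): the same for every circuit
  computing an `S`-state scan of `x₀ … x_{n-1}`, resp. of `x_{n-1} … x₀`, for each fixed `S`.
-/

set_option linter.dupNamespace false -- D-0017: single-problem summit ⇒ `QuantumAdvantage.QuantumAdvantage` by design

noncomputable section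

namespace Summit.QuantumAdvantage.QuantumAdvantage.Theorems.LiouvilleOrthogonalTC0

open Filter Finset
open Literature.Computability.Complexity
open Literature.Probability.RandomGraphs.LowDegree (sgn)

/-- **Kalai's `TC⁰` conjecture on circuits ignoring the low digits (unconditional).** For every
unbounded `ψ : ℕ → ℕ` and `ε > 0`, eventually in `n`: every circuit `C` on the `n` binary digits —
over ANY gate basis, of any depth and size — whose value does not depend on the inputs `x_i`,
`i < ψ(n)`, satisfies `|Σ_{N<2ⁿ} μ(N) sgn C(bits N)| ≤ ε 2ⁿ` (Matomäki–Radziwiłł for `μ` on aligned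
dyadic blocks, `stub_topDigits_moebius`, after monotonising `ψ`). -/
theorem moebius_orthogonal_circuit_topDigits (ψ : ℕ → ℕ) (hψ' : Tendsto ψ atTop atTop) :
    ∀ ε : ℝ, 0 < ε → ∀ᶠ n : ℕ in atTop, ∀ C : Circuit (Fin n),
      (∀ x y : Fin n → Bool, (∀ i : Fin n, ψ n ≤ (i : ℕ) → x i = y i) → C.eval x = C.eval y) →
        |∑ N ∈ Finset.range (2 ^ n), ((ArithmeticFunction.moebius N : ℤ) : ℝ) *
            sgn (C.eval (fun i : Fin n => Nat.testBit N i))| ≤ ε * (2 : ℝ) ^ n := by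
  obtain ⟨ψ', hmono, htend, hle⟩ := exists_monotone_minorant ψ hψ'
  intro ε hε
  filter_upwards [stub_topDigits_moebius ψ' hmono htend ε hε] with n hn C hC
  set G : ℕ → Bool := fun u => C.eval (fun i : Fin n => Nat.testBit (u * 2 ^ ψ n) i) with hG
  have key : ∀ N : ℕ, C.eval (fun i : Fin n => Nat.testBit N i) =
      G ((N / 2 ^ ψ' n) / 2 ^ (ψ n - ψ' n)) := by
    intro N
    have h1 : C.eval (fun i : Fin n => Nat.testBit N i) = G (N / 2 ^ ψ n) :=
      hC _ _ fun i hi => testBit_eq_testBit_div_mul hi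
    rw [h1, Nat.div_div_eq_div_mul, ← pow_add, Nat.add_sub_cancel' (hle n)]
  simp only [key]
  exact hn (fun u => G (u / 2 ^ (ψ n - ψ' n)))

/-- **Kalai's `TC⁰` conjecture on finite-state scans, LSB first (modulo Müllner's theorem).** Assuming
`mullner_moebius_automatic`: for every `S` and `ε > 0`, eventually in `n`, every circuit computing on
`{0,1}ⁿ` the output of some `S`-state automaton scanning `x₀, x₁, …, x_{n-1}` satisfies
`|Σ_{N<2ⁿ} μ(N) sgn C(bits N)| ≤ ε 2ⁿ`. -/
theorem moebius_orthogonal_circuit_scan_of_mullner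
    (hM : Literature.NumberTheory.LFunctions.mullner_moebius_automatic) (S : ℕ) :
    ∀ ε : ℝ, 0 < ε → ∀ᶠ n : ℕ in atTop, ∀ C : Circuit (Fin n),
      (∃ (δ : Fin S → Bool → Fin S) (q₀ : Fin S) (τ : Fin S → Bool),
        ∀ x : Fin n → Bool, C.eval x = τ (List.foldl δ q₀ (List.ofFn x))) →
        |∑ N ∈ Finset.range (2 ^ n), ((ArithmeticFunction.moebius N : ℤ) : ℝ) *
            sgn (C.eval (fun i : Fin n => Nat.testBit N i))| ≤ ε * (2 : ℝ) ^ n := by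
  intro ε hε
  filter_upwards [stub_scan_moebius hM S ε hε] with n hn C hC
  obtain ⟨δ, q₀, τ, hC⟩ := hC
  simp only [hC]
  exact (hn δ q₀ τ).1

/-- **Kalai's `TC⁰` conjecture on finite-state scans, MSB first (modulo Müllner's theorem).** As
`moebius_orthogonal_circuit_scan_of_mullner`, for automata scanning `x_{n-1}, …, x₀`. -/
theorem moebius_orthogonal_circuit_scanMSB_of_mullner
    (hM : Literature.NumberTheory.LFunctions.mullner_moebius_automatic) (S : ℕ) :
    ∀ ε : ℝ, 0 < ε → ∀ᶠ n : ℕ in atTop, ∀ C : Circuit (Fin n),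
      (∃ (δ : Fin S → Bool → Fin S) (q₀ : Fin S) (τ : Fin S → Bool),
        ∀ x : Fin n → Bool, C.eval x = τ (List.foldl δ q₀ (List.ofFn x).reverse)) →
        |∑ N ∈ Finset.range (2 ^ n), ((ArithmeticFunction.moebius N : ℤ) : ℝ) *
            sgn (C.eval (fun i : Fin n => Nat.testBit N i))| ≤ ε * (2 : ℝ) ^ n := by
  intro ε hε
  filter_upwards [stub_scan_moebius hM S ε hε] with n hn C hC
  obtain ⟨δ, q₀, τ, hC⟩ := hC
  simp only [hC]
  exact (hn δ q₀ τ).2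

end Summit.QuantumAdvantage.QuantumAdvantage.Theorems.LiouvilleOrthogonalTC0
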